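import Literature.AnabelianGeometry.EtaleTheta.Discharge.Sec2HasMuLIffTrivialAction
import Literature.AnabelianGeometry.EtaleTheta.Discharge.Sec1DeltaThetaZHat
import Literature.AnabelianGeometry.EtaleTheta.ThetaCoversTemperedOfHuuSection
import HarnessLib

/-!
# [EtTh] §1/§2: `[Δ_Θ : l·Δ_Θ] = l` at EVERY setting of [EtTh] origin under the closedness binder `hYcl` — so the equivalence
# «`HasMuL` ⟺ `Π^tp_X` acts trivially on `Δ_Θ/l·Δ_Θ`» (p470982) needs NO cyclotome datum (proof-only)

S. Mochizuki, *The étale theta function and its Frobenioid-theoretic manifestations*, Publ. RIMS **45** (2009) [EtTh], §1 p. 12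
(«`(Ẑ(1) ≅) Δ_Θ`»), §2 Def. 2.1 p. 35 («`Δ̄_Θ ≅ (ℤ/lℤ)(1)`»), Rmk. 2.6.1 p. 40 [cite: MochizukiEtTh2009, Def 2.1 p.35]. Cell abc-iut, layer L2,
seat abc-iut-L2-t10 (gen 7); sequel of p470982 (`Sec2HasMuLIffTrivialAction`). PROOF-ONLY (0 definitions).

p470982's `HasMuL ↔ hμ` took the numerology `hidx : [Δ_Θ : l·Δ_Θ] = l` as an INPUT (discharged there by a cyclotome datum
`μ : CyclotomeMod 1 l`). Here `hidx` is DERIVED from abc-iut-L2-d1's `Δ_Θ ≃* Ẑ` (`IsEtThOrigin.nonempty_deltaTheta_mulEquiv_zHat`,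
`Sec1DeltaThetaZHat`: freeness guard `IsEtThOrigin` + the closedness binder `hYcl` «the image of `Δ^tp_Y` in `Δ^Θ_X` is closed modulo
`[[Δ_X,Δ_X],Δ_X]⁻`», GAP-LEDGER G-w4d021-2 — a theorem at every model of the cell, e.g. `hYcl_modelχ'`, `hYcl_modelκ'`):

* `ZHatLevel.index_ker_level` — `[Ẑ : Ẑ^n] = n` (`Ker(Ẑ → ℤ/n) = Ẑ^n`, abc-iut-L4's `level_eq_one_iff_exists_pow`);
* `ThetaSetting.relIndex_lDeltaTheta_of_mulEquiv_zHat` — any abstract `Δ_Θ ≃* Ẑ` gives `[Δ_Θ : l·Δ_Θ] = l`;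
  **`ThetaSetting.IsEtThOrigin.relIndex_lDeltaTheta_of_hYcl`** — hence under `IsEtThOrigin + hYcl`;
* **`CLevelData.temperedCoverDataOfHuuOfSection_hasMuL_iff_of_hYcl`** (and `…OfSection…`, `temperedCoverData_hasMuL_iff_of_hYcl`) — for
  the three setting-born constructors at ANY `MuTwoSetting` of [EtTh] origin with `hYcl` (odd `l`): **`T.HasMuL ↔ hμ`, NO cyclotome datum**;
* `SettingModel.hasMuL_coverOfRecordχ'_iff_hμ` — the instance at the Kummer-carrying `χ′` (`hYcl_modelχ'`), for THE R312 cover of record.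

HONEST LIMITS: `hYcl` stays an explicit binder (not derivable from the root interface); the cyclotome datum is still what identifies `hμ`
with print's «`K ⊇ μ_l`» (p470982 §3); nothing of [EtTh] asserted; no side taken on [IUTchIII] Cor. 3.12; typed ≠ proved.
-/

noncomputable section

open CategoryTheory ProfiniteGrp ProfiniteGrp.ProfiniteCompletion

namespace Literature.AnabelianGeometry.EtaleTheta

/-! ### `[Ẑ : Ẑ^n] = n` -/

namespace ZHatLevel

/-- **`[Ẑ : Ẑ^n] = n`**: the kernel of `Ẑ → ℤ/n` (= the `n`-th powers, `level_eq_one_iff_exists_pow`) has index `n` (`level n` is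
onto: `level n (η k) = k mod n`; cf. the toy-model copy `IUT.HodgeArakelov.Prop13Toy.level_surjective`). [cite: RibesZalesskii2010, Thm 2.7.1] -/
theorem index_ker_level (n : ℕ+) : (level n).ker.index = n := by
  haveI : NeZero (n : ℕ) := NeZero.of_pos n.pos
  have hsurj : Function.Surjective (level n) := fun m => by
    obtain ⟨k, hk⟩ := ZMod.intCast_surjective (Multiplicative.toAdd m)
    exact ⟨eta k, by rw [level_eta, hk, ofAdd_toAdd]⟩
  rw [Subgroup.index_ker, MonoidHom.range_eq_top.mpr hsurj, Subgroup.card_top,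
    Nat.card_congr (Multiplicative.toAdd : Multiplicative (ZMod n) ≃ ZMod n)]
  exact Nat.card_zmod n

end ZHatLevel

/-! ### `[Δ_Θ : l·Δ_Θ] = l` from `Δ_Θ ≃* Ẑ` -/

namespace ThetaSetting

open Literature.AnabelianGeometry.SemiGraphs

variable {p : ℕ} [Fact p.Prime] (D : ThetaSetting p)

/-- **Any abstract isomorphism `Δ_Θ ≃* Ẑ` gives `[Δ_Θ : l·Δ_Θ] = l`**: `l·Δ_Θ` (the `l`-th powers of the commutative `Δ_Θ`)
corresponds to `Ẑ^l = Ker(Ẑ → ℤ/l)`. [cite: MochizukiEtTh2009, Def 2.1 p.35] -/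
theorem relIndex_lDeltaTheta_of_mulEquiv_zHat (e : ↥D.DeltaTheta ≃* ZHat) (l : ℕ+) :
    (D.lDeltaTheta l).relIndex D.DeltaTheta = l := by
  have hsub : (D.lDeltaTheta l).subgroupOf D.DeltaTheta = (ZHatLevel.level l).ker.comap e.toMonoidHom := by
    ext x
    rw [Subgroup.mem_subgroupOf, Subgroup.mem_comap, MonoidHom.mem_ker, MulEquiv.coe_toMonoidHom,
      ZHatLevel.level_eq_one_iff_exists_pow]
    constructor
    · rintro ⟨y, hy, hyx⟩
      refine ⟨e ⟨y, hy⟩, ?_⟩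
      rw [← map_pow]
      congr 1
      exact Subtype.ext hyx
    · rintro ⟨z, hz⟩
      refine ⟨((e.symm z : D.DeltaTheta) : D.GtpTheta), (e.symm z).2, ?_⟩
      have h : e.symm z ^ (l : ℕ) = x := e.injective (by rw [map_pow, e.apply_symm_apply, hz])
      exact congrArg Subtype.val h
  rw [Subgroup.relIndex, hsub, Subgroup.index_comap_of_surjective _ e.surjective]
  exact ZHatLevel.index_ker_level l

variable {D}

/-- **`[Δ_Θ : l·Δ_Θ] = l` at every setting of [EtTh] origin under `hYcl`** (abc-iut-L2-d1's `Δ_Θ ≃* Ẑ`).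
[cite: MochizukiEtTh2009, §1 p.12] -/
theorem IsEtThOrigin.relIndex_lDeltaTheta_of_hYcl (hO : D.IsEtThOrigin)
    (hYcl : (D.DtpY.map D.toHat.toMonoidHom).topologicalClosure ≤
      D.DtpY.map D.toHat.toMonoidHom ⊔ (⁅⁅D.DeltaHat, D.DeltaHat⁆, D.DeltaHat⁆).topologicalClosure) (l : ℕ+) :
    (D.lDeltaTheta l).relIndex D.DeltaTheta = l := by
  obtain ⟨e⟩ := hO.nonempty_deltaTheta_mulEquiv_zHat hYcl
  exact D.relIndex_lDeltaTheta_of_mulEquiv_zHat e l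

/-- The `ℕ`-indexed form for odd `l` (as the cover constructors carry it). [cite: MochizukiEtTh2009, §1 p.12] -/
theorem IsEtThOrigin.relIndex_lDeltaTheta_of_hYcl_of_odd (hO : D.IsEtThOrigin)
    (hYcl : (D.DtpY.map D.toHat.toMonoidHom).topologicalClosure ≤
      D.DtpY.map D.toHat.toMonoidHom ⊔ (⁅⁅D.DeltaHat, D.DeltaHat⁆, D.DeltaHat⁆).topologicalClosure) {l : ℕ} (hodd : Odd l) :
    (D.lDeltaTheta l).relIndex D.DeltaTheta = l :=
  hO.relIndex_lDeltaTheta_of_hYcl hYcl ⟨l, by obtain ⟨k, hk⟩ := hodd; omega⟩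

end ThetaSetting

/-! ### `HasMuL ↔ hμ` with NO cyclotome datum -/

namespace MuTwoSetting.CLevelData

open Literature.AnabelianGeometry.SemiGraphs ThetaCovers

variable {p : ℕ} [Fact p.Prime] {M : MuTwoSetting p}
variable {PC : Type} [Group PC] [TopologicalSpace PC] [IsTopologicalGroup PC] [T2Space PC]

/-- **`HasMuL ↔ hμ` for the R312 constructor of record, NO cyclotome datum** — at any `MuTwoSetting` of [EtTh] origin (`op`) with the
closedness binder `hYcl`, odd `l`. [cite: MochizukiEtTh2009, Rmk 2.6.1 p.40] -/
theorem temperedCoverDataOfHuuOfSection_hasMuL_iff_of_hYcl (e : M.CLevelData) (ιC : M.GtpC →ₜ* PC)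
    (hιC : IsProfiniteCompletion ιC) (hinj : Function.Injective ιC) (op : M.toThetaSetting.OncePuncturedData) {l : ℕ}
    (hodd : Odd l) (s : ↥M.GK →* M.PiTemp) (hsa : ∀ σ, M.aug (s σ) = (σ : GQp p)) (hsZ : ∀ σ, M.toZ (s σ) = 1)
    (hιell : ∀ c ∈ (e.piCDataOf ιC hιC).augGK.ker, c ∉ (e.piCDataOf ιC hιC).PiX →
      ∀ d ∈ (e.piCDataOf ιC hιC).PiX ⊓ (e.piCDataOf ιC hιC).augGK.ker,
        c * d * c⁻¹ * d ∈ (e.piCDataOf ιC hιC).barTheta l)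
    (hN : ((M.GtpXu l).map M.inclX).Normal) (hY : (M.GtpY.map M.inclX).Normal)
    {E : M.toThetaSetting.EtaleThetaData} (C : E.DoubleUnderline l) (hK : M.barKerTp l ≤ C.Huu)
    (hsH : ∀ σ, s σ ∈ C.Huu) {g : M.GtpC} (hgX : g ∉ M.inclX.range) (hι : C.IotaStable (e.conjX g))
    (hYcl : (M.DtpY.map M.toHat.toMonoidHom).topologicalClosure ≤
      M.DtpY.map M.toHat.toMonoidHom ⊔ (⁅⁅M.DeltaHat, M.DeltaHat⁆, M.DeltaHat⁆).topologicalClosure) :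
    (e.temperedCoverDataOfHuuOfSection ιC hιC hinj op hodd s hsa hsZ hιell hN hY C hK hsH hgX hι).HasMuL ↔
      ∀ (σ : M.PiTemp) (a : M.GtpTheta), a ∈ M.DeltaTheta →
        M.toTheta σ * a * (M.toTheta σ)⁻¹ * a⁻¹ ∈ M.lDeltaTheta l :=
  e.temperedCoverDataOfHuuOfSection_hasMuL_iff ιC hιC hinj op hodd s hsa hsZ hιell hN hY C hK hsH hgX hι
    (op.origin.relIndex_lDeltaTheta_of_hYcl_of_odd hYcl hodd)

/-- **`HasMuL ↔ hμ` for `temperedCoverDataOfSection`, NO cyclotome datum.** [cite: MochizukiEtTh2009, Rmk 2.6.1 p.40] -/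
theorem temperedCoverDataOfSection_hasMuL_iff_of_hYcl (e : M.CLevelData) (ιC : M.GtpC →ₜ* PC)
    (hιC : IsProfiniteCompletion ιC) (hinj : Function.Injective ιC) (op : M.toThetaSetting.OncePuncturedData) {l : ℕ}
    (hodd : Odd l) (s : ↥M.GK →* M.PiTemp) (hsa : ∀ σ, M.aug (s σ) = (σ : GQp p)) (hsZ : ∀ σ, M.toZ (s σ) = 1)
    (hsc : Continuous s)
    (hιell : ∀ c ∈ (e.piCDataOf ιC hιC).augGK.ker, c ∉ (e.piCDataOf ιC hιC).PiX →
      ∀ d ∈ (e.piCDataOf ιC hιC).PiX ⊓ (e.piCDataOf ιC hιC).augGK.ker,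
        c * d * c⁻¹ * d ∈ (e.piCDataOf ιC hιC).barTheta l)
    (hN : ((M.GtpXu l).map M.inclX).Normal) (hY : (M.GtpY.map M.inclX).Normal)
    (hYcl : (M.DtpY.map M.toHat.toMonoidHom).topologicalClosure ≤
      M.DtpY.map M.toHat.toMonoidHom ⊔ (⁅⁅M.DeltaHat, M.DeltaHat⁆, M.DeltaHat⁆).topologicalClosure) :
    (e.temperedCoverDataOfSection ιC hιC hinj op hodd s hsa hsZ hsc hιell hN hY).HasMuL ↔
      ∀ (σ : M.PiTemp) (a : M.GtpTheta), a ∈ M.DeltaTheta →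
        M.toTheta σ * a * (M.toTheta σ)⁻¹ * a⁻¹ ∈ M.lDeltaTheta l :=
  e.temperedCoverDataOfSection_hasMuL_iff ιC hιC hinj op hodd s hsa hsZ hsc hιell hN hY
    (op.origin.relIndex_lDeltaTheta_of_hYcl_of_odd hYcl hodd)

/-- **`HasMuL ↔ hμ` for abc-iut-L2-d3's geometric-cusp constructor `temperedCoverData`, NO cyclotome datum.**
[cite: MochizukiEtTh2009, Rmk 2.6.1 p.40] -/
theorem temperedCoverData_hasMuL_iff_of_hYcl (e : M.CLevelData) (ιC : M.GtpC →ₜ* PC)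
    (hιC : IsProfiniteCompletion ιC) (hinj : Function.Injective ιC) (op : M.toThetaSetting.OncePuncturedData)
    {l : ℕ} (hodd : Odd l) {x : M.Pt} (hx : M.IsCusp x)
    (hIx : ((e.piCDataOf ιC hιC).Dx x ⊓ (e.piCDataOf ιC hιC).augGK.ker) ⊔ (e.piCDataOf ιC hιC).barKer l =
      (e.piCDataOf ιC hιC).barTheta l)
    (hιell : ∀ c ∈ (e.piCDataOf ιC hιC).augGK.ker, c ∉ (e.piCDataOf ιC hιC).PiX →
      ∀ d ∈ (e.piCDataOf ιC hιC).PiX ⊓ (e.piCDataOf ιC hιC).augGK.ker,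
        c * d * c⁻¹ * d ∈ (e.piCDataOf ιC hιC).barTheta l)
    (hN : ((M.GtpXu l).map M.inclX).Normal) (hY : (M.GtpY.map M.inclX).Normal) {S : Subgroup PC}
    (hS : ((e.piCDataOf ιC hιC).coverDataAx l op hx hodd hIx hιell
        ((e.piCDataOf ιC hιC).inv_theta_of_inv_ell l op hιell)).toCoverData.IsSplitting S)
    (hSc : IsClosed (S : Set PC))
    (hYcl : (M.DtpY.map M.toHat.toMonoidHom).topologicalClosure ≤
      M.DtpY.map M.toHat.toMonoidHom ⊔ (⁅⁅M.DeltaHat, M.DeltaHat⁆, M.DeltaHat⁆).topologicalClosure) :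
    (e.temperedCoverData ιC hιC hinj op hodd hx hIx hιell hN hY hS hSc).HasMuL ↔
      ∀ (σ : M.PiTemp) (a : M.GtpTheta), a ∈ M.DeltaTheta →
        M.toTheta σ * a * (M.toTheta σ)⁻¹ * a⁻¹ ∈ M.lDeltaTheta l :=
  e.temperedCoverData_hasMuL_iff ιC hιC hinj op hodd hx hIx hιell hN hY hS hSc
    (op.origin.relIndex_lDeltaTheta_of_hYcl_of_odd hYcl hodd)

end MuTwoSetting.CLevelData

/-! ### The instance at the Kummer-carrying `χ′` (no cyclotome datum, no `hidx`) -/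

namespace SettingModel

open Literature.AnabelianGeometry.SemiGraphs ThetaCovers ThetaSetting

variable (p : ℕ) [Fact p.Prime]

/-- **At `χ′`, for THE R312 cover of record: `T.HasMuL ↔ hμ`** (abc-iut-w5-d029's `hYcl_modelχ'`; odd `l`, any `E / C / eX`, `Prop` inputs
arbitrary) — the μ-free abstract route; with p466422's `hμ ⟺ l ∣ p − 1 ∨ (p = 2 ∧ l = 2)` it recovers p467907 once more.
[cite: MochizukiEtTh2009, Rmk 2.6.1 p.40] -/
theorem hasMuL_coverOfRecordχ'_iff_hμ {E : (ThetaSetting.modelχ' p).EtaleThetaData} {l : ℕ+} (hodd : Odd (l : ℕ))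
    (C : E.DoubleUnderline (l : ℕ)) (eX : (ThetaSetting.modelχ' p).OncePuncturedData)
    (hK : (MuTwoSetting.inversionModelχ' p).barKerTp l ≤ C.Huu) (hsH : ∀ σ, sectionχ' p σ ∈ C.Huu)
    (hι : C.IotaStable ((cLevelDataInvχ' p).conjX (epsPMInvχ p))) :
    ((cLevelDataInvχ' p).temperedCoverDataOfHuuOfSection (cLevelDataInvχ' p).toPiCHat
      (cLevelDataInvχ' p).isProfiniteCompletion_toPiCHat (cLevelDataInvχ' p).toPiCHat_injective eX hodd (sectionχ' p)
      (aug_sectionχ' p) (toZ_sectionχ' p) (inv_ell_piCData_inversionModelχ' p l eX)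
      ((cLevelDataInvχ' p).map_inclX_GtpXu_normal l (kerToZIsCompactlyGenerated_modelχ' p))
      ((cLevelDataInvχ' p).map_inclX_GtpY_normal (kerToZIsCompactlyGenerated_modelχ' p)) C hK hsH
      (epsPMInvχ_not_mem_range p) hι).HasMuL ↔
      ∀ (σ : (MuTwoSetting.inversionModelχ' p).PiTemp) (a : (MuTwoSetting.inversionModelχ' p).GtpTheta),
        a ∈ (MuTwoSetting.inversionModelχ' p).DeltaTheta →
        (MuTwoSetting.inversionModelχ' p).toTheta σ * a * ((MuTwoSetting.inversionModelχ' p).toTheta σ)⁻¹ * a⁻¹ ∈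
          (MuTwoSetting.inversionModelχ' p).lDeltaTheta l :=
  (cLevelDataInvχ' p).temperedCoverDataOfHuuOfSection_hasMuL_iff_of_hYcl _ _ _ eX hodd _ _ _ _ _ _ C hK hsH _ hι
    (hYcl_modelχ' p)

end SettingModel

end Literature.AnabelianGeometry.EtaleTheta

end
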